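import Literature.IUT.HodgeTheaters.Cor53iiiAtGoodPlace
import Literature.IUT.HodgeTheaters.Cor53iiiAtBadPlace
import Literature.IUT.HodgeTheaters.Cor53iiiAtArchPlace
import HarnessLib

/-!
# [IUTchI] Cor 5.3 (iii) — THREE-SLOT KNIT of the `⊢`-telescope of record: at EVERY index of the genuine `ℱ`-kit (good nonarchimedean ·
# bad · archimedean) «the natural map `Isom(¹𝔉⊢, ²𝔉⊢) → Isom(¹𝔇⊢, ²𝔇⊢)` is surjective», each slot RE-EXPORTED BY NAME from its landed file and
# the three conjoined under the kit's binders only (abc-iut-L5-t4, row R83 (2a) knit; PROOF-ONLY — 0 def · 0 instance · 0 notation · no `Prop` fact)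

S. Mochizuki, *Inter-universal Teichmüller theory I*, kurims manuscript (May 2020), §5 Corollary 5.3 (iii) p. 144 l. 16–19: «For `i = 1, 2`, let `ⁱ𝔉⊢`
be an `ℱ⊢`-prime-strip; `ⁱ𝔇⊢` the `𝒟⊢`-prime-strip associated to `ⁱ𝔉⊢` [cf. Remark 5.2.1, (i)]. Then the natural map `Isom(¹𝔉⊢, ²𝔉⊢) → Isom(¹𝔇⊢, ²𝔇⊢)`
[cf. Remark 5.2.1, (i)] is surjective»; proof p. 144 l. 33–36: «follows immediately from […] [AbsTopIII], Proposition 5.8, (ii), (v)»; Definition 5.2 (ii)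
p. 134 («(a) if `v ∈ 𝕍^non`, then `‡ℱ⊢_v` is a split Frobenioid […] which admits an isomorphism `‡ℱ⊢_v ⥲ ℱ⊢_v`»; «(b) if `v ∈ 𝕍^arc`, then `‡ℱ⊢_v` is a
triple […] such that there exists an isomorphism of collections of data `‡ℱ⊢_v ⥲ ℱ⊢_v`»), (iii) p. 134 («a collection of isomorphisms, indexed by `𝕍`,
between the various constituent objects»). ([IUTchI] Cor 5.3 (iii) p.144) [claim: Mochizuki2012, status: disputed] (D-0012 claim key, series status
DISPUTED — a CONJUNCTION of three landed kernel theorems over abc-iut's GENUINE local carriers; nothing of the series is asserted; no side is taken on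
[IUTchIII] Cor. 3.12).

## What this file proves (cell abc-iut, L5 HUB node `IUTchI:Cor5.3(iii)`; abc-iut-L5-lead RULINGS #151 (2a) «THREE-SLOT KNIT»)

A morphism of `ℱ⊢`-prime-strips is «indexed by `𝕍`» (Def 5.2 (iii)), so the surjectivity of (iii) is the conjunction, over the index set of the kit, of the
three per-place surjectivities — each already a THEOREM of the tree at the genuine carrier of its place type:

| slot | index `x` of `D.IndexCopy` | carrier (abc-iut-L5-t2's genuine kit `GenuineFKitOfBadLocal`) | landed headline (re-exported here BY NAME) | census (#110 (4)) |
|---|---|---|---|---|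
| GOOD | `x ∉ D.indexCopyArc` | `(D.frobeniusGoodAt CG hA B I x hx).Cdash → 𝒟⊢_v̲ = CosetCat Gal(K̄_v̲/K_v̲)` | abc-iut-L5-t16 `Cor53iii.exists_dashLift_frobeniusGoodAt_of_equivalence` (★ p520897 / ★ p521802) | binders {kit, `I`, `x`, `hx`, `E`} · LAW ∅ · FACT ∅ · side ∅ · DATA ∅ |
| BAD | `x ∈ D.indexCopyBad` | `(D.frobeniusBadAt B I x hx).Cdash → (…).Ddash` (`τ⊢ = τ(q̲_v̲)`) | abc-iut-L5-t4 `Cor53iii.exists_badDashLift_frobeniusBadAt_of_equivalence` (★ p523255) | binders {kit, `I`, `x`, `hx`, `E`} · LAW ∅ · FACT ∅ · side ∅ · DATA ∅ |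
| ARCH | `x ∈ D.indexCopyArc` | triples `(‡𝒞⊢_v, ‡τ⊢_v, ‡M)` over `(D.frobeniusArcAt x hx).Cv / .OC` (`= ArchLocalFrobenioid.ofArchFrd`, rfl) ADMITTING an iso to `ArchDashTriple.model` | abc-iut-L5-t4 `Cor53iii.arch_dashLiftsAll` (p525809) | binders {`T₁`, `T₂`, `g`} · LAW ∅ · FACT ∅ · side ∅ · DATA {`T₁`, `T₂`, `g`} |

* §1 `good_dashLiftsAll` — GOOD slot at the merge term, by name; §2 `bad_dashLiftsAll` — BAD slot at the merge term, by name; §3 `arch_dashLiftsAll_frobeniusArcAt`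
  — ARCH slot over the merge term's archimedean carrier, by name, with its term-level NON-VACUITY `nonempty_archDashTriple_frobeniusArcAt` (the model
  triple inhabits the slot at every archimedean index);
* §4 **`Cor53iii.threeSlot_dashLiftsAll`** — the CONJUNCTION of the three under the kit's binders {`D`, `CG`, `hA`, `B`, `I`} only: at every index of every
  place type, every isomorphism of the `𝒟⊢`-constituent lifts to an isomorphism of the `ℱ⊢`-datum («surjective», print l. 16–19, and no more).
READINGS (each inherited from its slot file, unchanged): GOOD/BAD — «lifts» = a self-equivalence `Ψ` of `𝒞⊢_v̲` LYING UNDER the given self-equivalence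
`E` of `𝒟⊢_v̲` through `(…).CdashBase` AND preserving `τ⊢_v̲` (abc-iut-L5-t16 / abc-iut-L5-t4 `…DashSigmaLift`, [AbsTopIII] Prop 5.8 (ii) route via the
anabelian `σ_β` of [AbsAnab] Prop 1.2.1); ARCH — PRINT-DECOUPLED (the `𝒟⊢`-constituent IS the `𝕋𝕄⊢`-component, Def 4.1 (iii)(b); `SplitTopMonoid.Hom`
= `𝕋𝕄⊢`-ISOMORPHISMS; the [AbsTopIII] Rmk 5.8.1 (i) dilation lift is row R84, abc-iut-L5-t16 / abc-iut-L1-t6, NOT claimed).  NOT claimed: injectivity /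
rigidity at any slot (print's (iii) is surjectivity only); the (α) «BAD-ORBIT» rider (`τ(ζ q̲) ↦ τ(σ(ζ) q̲)` inside `tauDashOrbit`) is not in this file.
HONEST FRAMING: a lift over OUR carriers is OUR theorem; typed ≠ inhabited ≠ proved beyond what is here; nothing here asserts abc proved or refuted.
-/

noncomputable section

namespace Literature.IUT.HodgeTheaters

open CategoryTheory Opposite Literature.AnabelianGeometry.SemiGraphs Literature.AlgebraicGeometry.Frobenioids
open Literature.AnabelianGeometry.AbsoluteAnabelian Literature.NumberTheory.GaloisRepresentations
open scoped ValuativeRel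

namespace Cor53iii

section AtTerm

variable {F K Fbar : Type} [Field F] [NumberField F] [Field K] [NumberField K] [Algebra F K]
  [Field Fbar] [Algebra F Fbar] [Algebra K Fbar]
  {E : WeierstrassCurve F} [E.IsElliptic] {l : ℕ} {Pb : BadPlacePredicates K}
  (D : InitialThetaData F K Fbar E l Pb) (CG : D.geom.pe.CuspGalois) (hA : D.geom.pe.ArrowCoveringClaims)
  (B : ∀ v, v ∈ D.indexCopyBad → D.BadPairAt v) (I : D.MergeInputs B)

/-! ### §1. GOOD nonarchimedean slot (abc-iut-L5-t16, by name) -/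

/-- **GOOD `⊢`-SLOT of [IUTchI] Cor 5.3 (iii) at the merge term** — RE-EXPORT BY NAME of abc-iut-L5-t16's
`exists_dashLift_frobeniusGoodAt_of_equivalence`: at every nonarchimedean index `x ∉ D.indexCopyArc`, EVERY self-equivalence `E` of
`𝒟⊢_v̲ = CosetCat Gal(K̄_v̲/K_v̲)` lifts to a `τ⊢`-preserving self-equivalence of `(D.frobeniusGoodAt CG hA B I x hx).Cdash` lying under `E`.
([IUTchI] Cor 5.3 (iii) p.144) [claim: Mochizuki2012, status: disputed] -/
theorem good_dashLiftsAll (x : D.IndexCopy) (hx : x ∉ D.indexCopyArc) [Fact (D.primeAt x hx).Prime]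
    (E : CosetCat (AlgebraicClosure (D.KvAt x hx) ≃ₐ[D.KvAt x hx] AlgebraicClosure (D.KvAt x hx)) ≌
      CosetCat (AlgebraicClosure (D.KvAt x hx) ≃ₐ[D.KvAt x hx] AlgebraicClosure (D.KvAt x hx))) :
    letI := GaloisValDatum.normVal (D.KvAt x hx)
    ∃ Ψ : (D.frobeniusGoodAt CG hA B I x hx).Cdash ≌ (D.frobeniusGoodAt CG hA B I x hx).Cdash,
      Nonempty (CatIsomorphism.LiesUnder (D.frobeniusGoodAt CG hA B I x hx).CdashBase (D.frobeniusGoodAt CG hA B I x hx).CdashBase Ψ E) ∧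
      (D.frobeniusGoodAt CG hA B I x hx).tauDash.IsPreservedBy (D.frobeniusGoodAt CG hA B I x hx).tauDash Ψ.functor :=
  exists_dashLift_frobeniusGoodAt_of_equivalence D CG hA B I x hx E

/-! ### §2. BAD slot (abc-iut-L5-t4, by name) -/

/-- **BAD `⊢`-SLOT of [IUTchI] Cor 5.3 (iii) at the merge term** — RE-EXPORT BY NAME of `exists_badDashLift_frobeniusBadAt_of_equivalence`: at every bad
index `x ∈ D.indexCopyBad`, EVERY self-equivalence `E` of `(D.frobeniusBadAt B I x hx).Ddash` lifts to a self-equivalence of `(…).Cdash` lying under `E` through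
`(…).CdashBase` and preserving `(…).tauDash = τ(q̲_v̲)`. ([IUTchI] Cor 5.3 (iii) p.144) [claim: Mochizuki2012, status: disputed] -/
theorem bad_dashLiftsAll (x : D.IndexCopy) (hx : x ∈ D.indexCopyBad) (E : (D.frobeniusBadAt B I x hx).Ddash ≌ (D.frobeniusBadAt B I x hx).Ddash) :
    ∃ Ψ : (D.frobeniusBadAt B I x hx).Cdash ≌ (D.frobeniusBadAt B I x hx).Cdash,
      Nonempty (CatIsomorphism.LiesUnder (D.frobeniusBadAt B I x hx).CdashBase (D.frobeniusBadAt B I x hx).CdashBase Ψ E) ∧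
      (D.frobeniusBadAt B I x hx).tauDash.IsPreservedBy (D.frobeniusBadAt B I x hx).tauDash Ψ.functor :=
  exists_badDashLift_frobeniusBadAt_of_equivalence D B I x hx E

/-! ### §3. ARCHIMEDEAN slot (abc-iut-L5-t4, by name) over the merge term's archimedean carrier -/

/-- **NON-VACUITY of the ARCH `⊢`-slot at the merge term**: at every archimedean index `x ∈ D.indexCopyArc` the type of `ℱ⊢`-data over the term's carrier
`(D.frobeniusArcAt x hx).Cv / .OC` (`= ArchLocalFrobenioid.ofArchFrd`, rfl) is inhabited — by the MODEL triple `ArchDashTriple.model`.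
([IUTchI] Def 5.2 (ii) p.134) [claim: Mochizuki2012, status: disputed] -/
theorem nonempty_archDashTriple_frobeniusArcAt (x : D.IndexCopy) (hx : x ∈ D.indexCopyArc) :
    Nonempty (ArchDashTriple (D.frobeniusArcAt x hx).Cv (D.frobeniusArcAt x hx).OC) :=
  ⟨ArchDashTriple.model⟩

/-- **ARCH `⊢`-SLOT of [IUTchI] Cor 5.3 (iii) over the merge term's archimedean carrier** — BY NAME from `arch_dashLiftsAll`: at every archimedean index
`x ∈ D.indexCopyArc`, for ANY two `ℱ⊢`-data `T₁ T₂` over `(D.frobeniusArcAt x hx).Cv / .OC` and EVERY `𝕋𝕄⊢`-isomorphism `g : ¹M ⥲ ²M` of their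
`𝒟⊢`-constituents there is an isomorphism of triples `f` with `f.toDash = g` (PRINT-DECOUPLED reading; `SplitTopMonoid.Hom` = `𝕋𝕄⊢`-isomorphisms).
([IUTchI] Cor 5.3 (iii) p.144) [claim: Mochizuki2012, status: disputed] -/
theorem arch_dashLiftsAll_frobeniusArcAt (x : D.IndexCopy) (hx : x ∈ D.indexCopyArc)
    (T₁ T₂ : ArchDashTriple (D.frobeniusArcAt x hx).Cv (D.frobeniusArcAt x hx).OC) (g : SplitTopMonoid.Hom T₁.M T₂.M) :
    ∃ f : ArchDashTriple.Iso T₁ T₂, f.toDash = g :=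
  arch_dashLiftsAll T₁ T₂ g

/-! ### §4. The THREE-SLOT KNIT -/

/-- **[IUTchI] Cor 5.3 (iii) — THREE-SLOT KNIT at the genuine `ℱ`-kit of record, under the kit's binders {`D`, `CG`, `hA`, `B`, `I`} ONLY.**
«The natural map `Isom(¹𝔉⊢, ²𝔉⊢) → Isom(¹𝔇⊢, ²𝔇⊢)` is surjective», read index by index (Def 5.2 (iii): a morphism of `ℱ⊢`-prime-strips is a collection
of isomorphisms indexed by `𝕍`): (GOOD) at every `x ∉ D.indexCopyArc`, every self-equivalence of `𝒟⊢_v̲` lifts to a `τ⊢`-preserving self-equivalence of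
`(D.frobeniusGoodAt …).Cdash` lying under it; (BAD) at every `x ∈ D.indexCopyBad`, the same for `(D.frobeniusBadAt …).Cdash → (…).Ddash` with
`τ⊢ = τ(q̲_v̲)`; (ARCH) at every `x ∈ D.indexCopyArc`, the slot is inhabited and every `𝕋𝕄⊢`-isomorphism of `𝒟⊢`-constituents of any two `ℱ⊢`-data over
the term's carrier extends to an isomorphism of triples.  CENSUS: LAW ∅ · FACT ∅ · side ∅; GOOD ★ p520897/★ p521802 · BAD ★ p523255 · ARCH p525809, each
BY NAME.  NOT claimed: injectivity at any slot; the archimedean dilation lift (row R84). ([IUTchI] Cor 5.3 (iii) p.144) [claim: Mochizuki2012, status: disputed] -/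
theorem threeSlot_dashLiftsAll :
    (∀ (x : D.IndexCopy) (hx : x ∉ D.indexCopyArc) [Fact (D.primeAt x hx).Prime]
        (E : CosetCat (AlgebraicClosure (D.KvAt x hx) ≃ₐ[D.KvAt x hx] AlgebraicClosure (D.KvAt x hx)) ≌
          CosetCat (AlgebraicClosure (D.KvAt x hx) ≃ₐ[D.KvAt x hx] AlgebraicClosure (D.KvAt x hx))),
        letI := GaloisValDatum.normVal (D.KvAt x hx)
        ∃ Ψ : (D.frobeniusGoodAt CG hA B I x hx).Cdash ≌ (D.frobeniusGoodAt CG hA B I x hx).Cdash,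
          Nonempty (CatIsomorphism.LiesUnder (D.frobeniusGoodAt CG hA B I x hx).CdashBase (D.frobeniusGoodAt CG hA B I x hx).CdashBase Ψ E) ∧
          (D.frobeniusGoodAt CG hA B I x hx).tauDash.IsPreservedBy (D.frobeniusGoodAt CG hA B I x hx).tauDash Ψ.functor) ∧
    (∀ (x : D.IndexCopy) (hx : x ∈ D.indexCopyBad) (E : (D.frobeniusBadAt B I x hx).Ddash ≌ (D.frobeniusBadAt B I x hx).Ddash),
        ∃ Ψ : (D.frobeniusBadAt B I x hx).Cdash ≌ (D.frobeniusBadAt B I x hx).Cdash,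
          Nonempty (CatIsomorphism.LiesUnder (D.frobeniusBadAt B I x hx).CdashBase (D.frobeniusBadAt B I x hx).CdashBase Ψ E) ∧
          (D.frobeniusBadAt B I x hx).tauDash.IsPreservedBy (D.frobeniusBadAt B I x hx).tauDash Ψ.functor) ∧
    (∀ (x : D.IndexCopy) (hx : x ∈ D.indexCopyArc),
        Nonempty (ArchDashTriple (D.frobeniusArcAt x hx).Cv (D.frobeniusArcAt x hx).OC) ∧
        ∀ (T₁ T₂ : ArchDashTriple (D.frobeniusArcAt x hx).Cv (D.frobeniusArcAt x hx).OC) (g : SplitTopMonoid.Hom T₁.M T₂.M),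
          ∃ f : ArchDashTriple.Iso T₁ T₂, f.toDash = g) :=
  ⟨fun x hx _ E => good_dashLiftsAll D CG hA B I x hx E,
    fun x hx E => bad_dashLiftsAll D B I x hx E,
    fun x hx => ⟨nonempty_archDashTriple_frobeniusArcAt D x hx, fun T₁ T₂ g => arch_dashLiftsAll_frobeniusArcAt D x hx T₁ T₂ g⟩⟩

end AtTerm

end Cor53iii

end Literature.IUT.HodgeTheaters

end
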